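import Summits.BirchSwinnertonDyer.BirchSwinnertonDyer.Theorems.Rank1ResidualJetDerivedPointReduction
import Summits.BirchSwinnertonDyer.BirchSwinnertonDyer.Theorems.Rank1ResidualJetKolyvaginReduction
import Summits.BirchSwinnertonDyer.BirchSwinnertonDyer.Theorems.Rank1ResidualJetLocalTransverse
import Summits.BirchSwinnertonDyer.BirchSwinnertonDyer.Theorems.Rank1ResidualJetUnramifiedEigenCount
import Summits.BirchSwinnertonDyer.BirchSwinnertonDyer.Theorems.Rank1ResidualJetKolyvaginDecompositionTrivial
import Literature.NumberTheory.GaloisRepresentations.CompletionRestrictionRange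
import Literature.NumberTheory.GaloisRepresentations.DecompositionGroupOfCompletion
import Literature.NumberTheory.GaloisRepresentations.LocalGaloisGroupProofs
import Literature.NumberTheory.GaloisRepresentations.LocalGaloisGroupInertiaProofs
import Literature.NumberTheory.GaloisRepresentations.LocalGaloisGroupFrobeniusProofs
import Literature.NumberTheory.Automorphic.AdicCompletionLocalField
import Literature.NumberTheory.Automorphic.AdicCompletionResidueCard
import Literature.NumberTheory.EllipticCurves.SerreOpenImageOrdinaryInertiaProofs
import HarnessLib

/-!
# T1 JET (cell `bsd-jet`), road K — the completion-layer gap `htr` CLOSED: Kolyvagin's class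
# `c_k(c)` lies in Jetchev's transverse kernel at every prime `ℓ ∣ c` (Howard 2004, Lemma 2.7.3),
# for `d_K < -4`

HONEST FRAMING (programme file §HONESTY, verbatim): «no tranche here proves BSD; ARM L moves the
LITERAL column of an r ≤ 1 census into the kernel-proved-modulo-named-print column.» THEOREMS ONLY
(seat `bsd-jet-pv-2`, session g5; `--supports stmt-BirchSwinnertonDyer-14418`, helper); 0 classes
move. WHAT THIS IS. The END FORMS of road K (`JET.jetchevDivisibilityCarrier{Mult,Ne,Add}_of_localFacts`)
carry the binder `htr`: for the tree's concrete Kolyvagin data `d` at a square-free level `c` with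
Zhang–Kolyvagin prime factors and `k ≤ M(ℓ)`, `c_k(c) = d.kolyvaginClass p k` lies in
`transverseKer W K ι p^k ℓ` for every `ℓ ∣ c` — Jetchev 2008, p. 820 («known to satisfy the local
conditions»), Howard 2004, Lemma 2.7.3 (the transverseness half). This file PROVES it, with the
hypothesis `d_K < -4` of the END FORMS' context (which is necessary: BRICK B1's docstring).
Assembly (`kolyvaginClass_mem_transverseKer`): at a place `w'` of `K[ℓ]` over `λ = (ℓ)`, G2♯
(`localization_mem_transverseSubgroup_iff`) reduces to the vanishing of the class on
`Γ_{K[ℓ]_{w'}} → Γ_{K_λ} → Γ_K`; its image is the part of the decomposition group `D_{𝔓₀}`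
(`decompositionSubgroup_adicCompletionPrime_eq_range`) fixing `K[ℓ]` (typer's FILE A,
`mem_range_absGaloisRestrict_adicCompletion_iff`), hence fixing `K[c]` (BRICK B1) and the derived
point `P(c)`, on which McCallum's cocycle is `g ↦ gQ - Q` (`p^k Q = P(c)`); since `D_{𝔓₀}` fixes
`E[p^k]` (pv-1 `decompositionSubgroup_le_torsionFixing`) this is a continuous HOMOMORPHISM out of
the local group `Γ_{K[ℓ]_{w'}}`, killed by the local inertia (BRICK B2: the reduction at `𝔓₀` is
inertia-invariant and injective on `E[p^k]`; local inertia maps to `I_{𝔓₀}`,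
`absInertia_map_absGaloisRestrict_le`, `inertia_adicCompletionPrime_eq_map_absInertia`) and by a
Frobenius of `K[ℓ]_{w'}` (it acts as `z ↦ z^{ℓ^{2f}}` modulo `𝔓₀`, `IsFrobPow.absGaloisRestrict`;
BRICK B2 sends it to `φ^{2f}`, and `red Q` is fixed by `φ²` because `red P(c) = p^k • b` with
`φ² b = b`, BRICK B3, and `φ²` fixes `Ẽ[p^k]`) — so it vanishes (pv-1
`apply_eq_zero_of_unramified_of_apply_frob_eq_zero`). References: [cite: Howard2004HeegnerKolyvagin,
Lemma 2.7.3] [cite: Jetchev2008, §3.4.1 (p. 816), Prop. 4.6 (p. 820)] [cite: GrossLMS1991, §4 (4.4),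
(4.6)] [cite: McCallumLMS1991, Lemma 4.3] [cite: NeukirchANT1999, Ch. II §9 Prop. (9.6)].
-/

set_option autoImplicit false

noncomputable section

open scoped Classical Pointwise Valued

open WeierstrassCurve Field NumberField IsDedekindDomain Module ValuativeRel
  Literature.NumberTheory.EllipticCurves Literature.NumberTheory.EllipticCurves.RingClassField
  Literature.NumberTheory.EllipticCurves.ModularForms Literature.NumberTheory.EllipticCurves.Jetchev2008
  Literature.NumberTheory.EllipticCurves.KolyvaginCocycle
  Literature.NumberTheory.GaloisRepresentations Literature.NumberTheory.GaloisRepresentations.DiscreteGaloisModule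
  Literature.NumberTheory.GaloisRepresentations.IsNonarchimedeanLocalField
  Literature.NumberTheory.NumberFields Literature.NumberTheory.Automorphic Literature
  Summit.BirchSwinnertonDyer.Rank1Residual.X11b Summit.BirchSwinnertonDyer.Rank1Residual.JET.SelmerVocabulary

namespace Summit.BirchSwinnertonDyer.Rank1Residual.JET

variable {K : Type} [Field K] [NumberField K]

/-! ## §1 Local-to-global: Frobenius powers of `K_v` and cocycles vanishing on `Γ_{L_{w'}}` -/

/-- **Local Frobenius powers are global Frobenius powers at `𝔓₀`.** If `σ ∈ Γ_{K_v}` satisfies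
`σ • y ≡ y^Q` modulo the prime of `\bar K_v` for all integers `y` of `\bar K_v` (e.g. `IsFrobPow σ f`
with `Q = q_v^f`), then `res σ • s ≡ s^Q (mod 𝔓₀)` for all `s ∈ \bar ℤ_K`, `𝔓₀` the prime cut out by
`K̄ → \bar K_v` (the tree's `isArithFrobAt_absGaloisRestrict_of_isAbsArithFrob`, any exponent).
[cite: NeukirchANT1999, Ch. II §9 Prop. (9.6)] -/
theorem forall_smul_sub_pow_mem_adicCompletionPrime (v : HeightOneSpectrum (𝓞 K))
    {σ : absoluteGaloisGroup (v.adicCompletion K)} {Q : ℕ}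
    (hσ : ∀ y : absIntegers (valuation (v.adicCompletion K)).integer (v.adicCompletion K),
      σ • y - y ^ Q ∈ absMaximalIdeal (v.adicCompletion K))
    (s : absIntegers (𝓞 K) K) :
    absGaloisRestrict K (v.adicCompletion K) σ • s - s ^ Q ∈ adicCompletionPrime K v := by
  set L := v.adicCompletion K
  have hw := adicCompletion_valuation_le_one_iff K v
  have hO := norm_algebraMap_ringOfIntegers_le_one K v
  have hmem : ∀ s : absIntegers (𝓞 K) K,
      absClosureEmbedding K L s ∈ absIntegers (valuation L).integer L :=
    absClosureEmbedding_mem_absIntegers_integer K L (valuation L) (fun r => (hw _).mpr (hO r))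
  rw [mem_adicCompletionPrime_iff]
  have hy := (mem_radical_map_maximalIdeal_iff hw _).mp (hσ ⟨absClosureEmbedding K L s, hmem s⟩)
  have h_eq : absClosureEmbedding K L
        ((absGaloisRestrict K L σ • s - s ^ Q : absIntegers (𝓞 K) K) : AlgebraicClosure K) =
      ((σ • (⟨absClosureEmbedding K L s, hmem s⟩ : absIntegers (valuation L).integer L) -
        ⟨absClosureEmbedding K L s, hmem s⟩ ^ Q :
          absIntegers (valuation L).integer L) : AlgebraicClosure L) := by
    rw [Subalgebra.coe_sub, Subalgebra.coe_pow, map_sub, map_pow, integralClosure.coe_smul,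
      absGaloisRestrict_apply_smul, Subalgebra.coe_sub, Subalgebra.coe_pow,
      integralClosure.coe_smul]
  rw [h_eq]
  exact hy

/-- **Cocycle criterion for the intrinsic transverse condition.** For a continuous cocycle `φ` of
`Γ_K` in `E[n]`, a place `v`, a finite extension `L/K` with a place `w' ∣ v`: if
`φ (res_v (θ' g')) = 0` for every `g' ∈ Γ_{L_{w'}}` (`θ' : Γ_{L_{w'}} → Γ_{K_v}` the local base
change), then `loc_v [φ]` is `L_{w'}`-transverse (`ker(H¹(K_v) → H¹(L_{w'}))`).
[cite: MazurRubin2004, Def. 1.1.6] [cite: Jetchev2008, §3.1.2 (p. 814)] -/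
theorem localization_mem_transverseSubgroup_of_forall_apply_eq_zero (W : WeierstrassCurve K) (n : ℤ)
    (L : Type) [Field L] [NumberField L] [Algebra K L] (v : HeightOneSpectrum (𝓞 K))
    (w' : HeightOneSpectrum (𝓞 L)) [w'.asIdeal.LiesOver v.asIdeal]
    (φ : contOneCocycles (discreteTopRep (absoluteGaloisGroup K) (geomTorsion W n)))
    (h : ∀ g' : absoluteGaloisGroup (w'.adicCompletion L),
      φ.1 (absGaloisRestrict K (v.adicCompletion K)
        (letI := (adicCompletionOfLiesOver K L v w').toAlgebra
         absGaloisRestrict (v.adicCompletion K) (w'.adicCompletion L) g')) = 0) :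
    letI := (adicCompletionOfLiesOver K L v w').toAlgebra
    galoisCohomology.localization (W.torsionGaloisModule n) (Sum.inr v) 1 (oneCocycleClass _ φ) ∈
      transverseSubgroup (GaloisRep.toLocal v (W.torsionGaloisModule n)) (w'.adicCompletion L) := by
  letI := (adicCompletionOfLiesOver K L v w').toAlgebra
  let ρ := W.torsionGaloisModule n
  let M := geomTorsion W n
  let θ' : absoluteGaloisGroup (w'.adicCompletion L) →ₜ* absoluteGaloisGroup (v.adicCompletion K) :=
    absGaloisRestrict (v.adicCompletion K) (w'.adicCompletion L)
  let X : TopRep ℤ (absoluteGaloisGroup (v.adicCompletion K)) :=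
    DiscreteGaloisModule.toTopRep (ρ.toLocal (Sum.inr v : Place K))
  let Z : TopRep ℤ (absoluteGaloisGroup (w'.adicCompletion L)) :=
    DiscreteGaloisModule.toTopRep ((GaloisRep.toLocal v ρ).restrictField (w'.adicCompletion L))
  have hloc : galoisCohomology.localization ρ (Sum.inr v) 1 (oneCocycleClass _ φ) =
      oneCocycleClass X (contOneCocycles.pullback (absGaloisRestrict K (v.adicCompletion K))
        (TopRep.ofHom ⟨ContinuousLinearMap.id ℤ M, fun _ => rfl⟩) φ) :=
    map_oneCocycleClass _ _ _ φ
  have hres : ∀ ψ : contOneCocycles X,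
      galoisCohomology.res (GaloisRep.toLocal v ρ) (w'.adicCompletion L) 1 (oneCocycleClass X ψ) =
        oneCocycleClass Z (contOneCocycles.pullback θ'
          (TopRep.ofHom ⟨ContinuousLinearMap.id ℤ M, fun _ => rfl⟩) ψ) := fun ψ ↦
    map_oneCocycleClass _ _ _ ψ
  change galoisCohomology.res (GaloisRep.toLocal v ρ) (w'.adicCompletion L) 1
    (galoisCohomology.localization ρ (Sum.inr v) 1 (oneCocycleClass _ φ)) = 0
  rw [hloc, hres]
  refine (oneCocycleClass_eq_zero_iff _ _).mpr ⟨0, fun g' ↦ ?_⟩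
  rw [map_zero, sub_zero, contOneCocycles.pullback_apply, contOneCocycles.pullback_apply]
  exact h g'

/-! ## §2 `p^k ∤`-torsion lifts along the reduction -/

/-- Every `m`-torsion point of `Ẽ(𝔽̄_ℓ)` lifts to an `m`-torsion point of `E(K̄)` (`ℓ ∤ m`) under a
reduction map injective on `E[m]` (counting: `#E[m] = m² = #Ẽ[m]`, AEC III.6.4 (b); the `K̄`-version
of x11b3's `exists_torsion_lift`). [cite: SilvermanAEC2009, Prop. VII.3.1(b), Cor. III.6.4(b)] -/
theorem exists_torsion_lift_baseChange (W : WeierstrassCurve ℚ) [W.IsElliptic] [W.IsGloballyMinimal]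
    {ℓ : ℕ} [Fact ℓ.Prime] (hΔ : ¬ (ℓ : ℤ) ∣ minimalDiscriminantInt W)
    {red : geomPoints (W.baseChange K) →+ (reductionModPrime W ℓ).geomPoints}
    (hinj : ∀ m : ℕ, ¬ ℓ ∣ m → ∀ x, (m : ℤ) • x = 0 → red x = 0 → x = 0)
    {m : ℕ} (hm : ¬ ℓ ∣ m) (hm0 : m ≠ 0) (b : (reductionModPrime W ℓ).geomPoints)
    (hb : (m : ℤ) • b = 0) : ∃ P : geomPoints (W.baseChange K), (m : ℤ) • P = 0 ∧ red P = b := by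
  haveI : (reductionModPrime W ℓ).IsElliptic := isElliptic_reductionModPrime W hΔ
  haveI : (W.baseChange K).IsElliptic := by unfold WeierstrassCurve.baseChange; infer_instance
  have hmQ : (m : K) ≠ 0 := by exact_mod_cast hm0
  have hmF : (m : ZMod ℓ) ≠ 0 := by rw [ne_eq, ZMod.natCast_eq_zero_iff]; exact hm
  have hcE := KolyvaginH44.natCard_torsion_eq_sq (W.baseChange K) hmQ
  have hcB := KolyvaginH44.natCard_torsion_eq_sq (reductionModPrime W ℓ) hmF
  haveI : Finite {b : (reductionModPrime W ℓ).geomPoints // (m : ℤ) • b = 0} :=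
    Nat.finite_of_card_ne_zero (by rw [hcB]; exact pow_ne_zero 2 hm0)
  set f : {P : geomPoints (W.baseChange K) // (m : ℤ) • P = 0} →
      {b : (reductionModPrime W ℓ).geomPoints // (m : ℤ) • b = 0} :=
    fun P ↦ ⟨red P.1, by rw [← map_zsmul, P.2, map_zero]⟩ with hf
  have hfinj : Function.Injective f := by
    rintro ⟨P, hP⟩ ⟨P', hP'⟩ h
    have h' : red P = red P' := congrArg Subtype.val h
    apply Subtype.ext
    rw [← sub_eq_zero]
    refine hinj m hm _ ?_ (by rw [map_sub, h', sub_self])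
    rw [smul_sub, hP, hP', sub_zero]
  have hbij := Function.Injective.bijective_of_nat_card_le hfinj (by rw [hcE, hcB])
  obtain ⟨⟨P, hP⟩, hPb⟩ := hbij.2 ⟨b, hb⟩
  exact ⟨P, hP, congrArg Subtype.val hPb⟩

/-! ## §3 The theorem -/

section Main

variable (W : WeierstrassCurve ℚ) [W.IsElliptic] [W.IsGloballyMinimal] [NeZero (W.conductorNorm ℤ)]

/-- **Kolyvagin's class is transverse at the primes of its level** (Howard 2004, Lemma 2.7.3;
Jetchev 2008, p. 820: the classes `c_k(c)` «are known to satisfy the local conditions for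
`𝓕(c)`»). For `W/ℚ` globally minimal, `K` imaginary quadratic with `d_K < -4`, `p` odd, `c`
square-free all of whose prime factors are Zhang–Kolyvagin primes with `k ≤ M(ℓ)`, the tree's
concrete Kolyvagin data `d` at level `c` and a prime `ℓ ∣ c`: `d.kolyvaginClass p k ∈
transverseKer W K ι p^k ℓ`, i.e. `loc_{w'} res_{K[ℓ]/K} c_k(c) = 0` at every place `w' ∋ ℓ` of
`K[ℓ]`. This is the binder `htr` of the road-K END FORMS (`JET.jetchevDivisibilityCarrierMult_of_localFacts`
and twins) under the END FORMS' standing hypothesis `d_K ∉ {-3, -4}`.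
[cite: Howard2004HeegnerKolyvagin, Lemma 2.7.3] [cite: Jetchev2008, Prop. 4.6 (p. 820)]
[cite: GrossLMS1991, §4 (4.4), (4.6)] -/
theorem kolyvaginClass_mem_transverseKer (hK : IsImaginaryQuadratic K)
    (hD : NumberField.discr K < -4) {p : ℕ} [Fact p.Prime] (hp2 : p ≠ 2)
    (Dt : ModularParametrizationData W (W.conductorNorm ℤ)) (β : ℤ) (ι : K →+* ℂ)
    [∀ j : ℕ, NumberField (ringClassField K ι j)] (k : ℕ) {c : ℕ} (hc : Squarefree c)
    (hcK : ∀ ℓ ∈ c.primeFactors, Zhang2014.IsKolyvaginPrime (W.conductorNorm ℤ) W K p ℓ ∧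
      k ≤ Zhang2014.kolyvaginIndex W p ℓ)
    (d : KolyvaginHeegnerData Dt β ι c) {ℓ : ℕ} (hℓ : ℓ ∈ c.primeFactors) :
    (d.kolyvaginClass (Fact.out : p.Prime) k :
      galoisCohomology ((W.baseChange K).torsionGaloisModule ((p ^ k : ℕ) : ℤ)) 1) ∈
      transverseKer W K ι ((p ^ k : ℕ) : ℤ) ℓ := by
  have hp : p.Prime := Fact.out
  have hc0 : c ≠ 0 := hc.ne_zero
  obtain ⟨hℓK, hkM⟩ := hcK ℓ hℓ
  obtain ⟨hℓp, hℓN, -, hℓnep, hinertℓ, -⟩ := hℓK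
  haveI : Fact ℓ.Prime := ⟨hℓp⟩
  have hℓc : ℓ ∣ c := Nat.dvd_of_mem_primeFactors hℓ
  have hpk : p ^ k ∣ ℓ + 1 := (Zhang2014.le_kolyvaginIndex_iff.mp hkM).1
  have hinert : ∀ q ∈ c.primeFactors, (Ideal.span {(q : 𝓞 K)}).IsPrime := fun q hq ↦
    (hcK q hq).1.2.2.2.2.1
  -- `ℓ ∤ Δ_min` and `ℓ ∤ p^k`
  have hgood : W.HasGoodReductionAtPrime ℓ := by
    by_contra h
    exact hℓN ((dvd_conductorNorm_iff_not_hasGoodReductionAtPrime W ℓ).mpr h)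
  have hΔ : ¬ (ℓ : ℤ) ∣ minimalDiscriminantInt W :=
    not_dvd_minimalDiscriminantInt_of_hasGoodReductionAtPrime' W ℓ hgood
  have hℓpk : ¬ ℓ ∣ p ^ k := fun h ↦ hℓnep ((Nat.prime_dvd_prime_iff_eq hℓp hp).mp (hℓp.dvd_of_dvd_pow h))
  have hpk0 : p ^ k ≠ 0 := pow_ne_zero k hp.ne_zero
  set n : ℤ := ((p ^ k : ℕ) : ℤ) with hn
  set ρK := (W.baseChange K).torsionGaloisModule n with hρK
  -- the junk case
  by_cases hadm : KolyvaginCocycle.IsAdmissible (absoluteGaloisGroup K) d.pointsSubgroup n ∧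
      d.toGeomPoints d.derivedPoint ∈
        KolyvaginCocycle.invPoints (absoluteGaloisGroup K) d.pointsSubgroup n
  swap
  · rw [KolyvaginHeegnerData.kolyvaginClass, dif_neg hadm]
    exact zero_mem _
  obtain ⟨hA, hPinv⟩ := hadm
  set P : geomPoints (W.baseChange K) := d.toGeomPoints d.derivedPoint with hPdef
  have hdiv := (W.baseChange K).zsmul_geomPoints_surjective_of_charZero
    (n := n) (by rw [hn]; exact_mod_cast hpk0)
  obtain ⟨Q, hQ⟩ := hdiv P
  have hQ : n • Q = P := hQ
  rw [d.kolyvaginClass_of_admissible hp k hA hPinv, kolyvaginClass_eq_cls hA hPinv hQ]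
  -- the place `λ = (ℓ)`, the prime `𝔓₀` of the completion, the reduction
  have hne : Ideal.span {((ℓ : ℕ) : 𝓞 K)} ≠ ⊥ := by
    rw [Ne, Ideal.span_singleton_eq_bot]; exact_mod_cast hℓp.ne_zero
  let v : HeightOneSpectrum (𝓞 K) := ⟨Ideal.span {((ℓ : ℕ) : 𝓞 K)}, hinertℓ, hne⟩
  have hv : v.asIdeal = Ideal.span {((ℓ : ℕ) : 𝓞 K)} := rfl
  have hℓv : ((ℓ : ℕ) : 𝓞 K) ∈ v.asIdeal := Ideal.mem_span_singleton_self _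
  have huniq : ∀ w : HeightOneSpectrum (𝓞 K), (ℓ : 𝓞 K) ∈ w.asIdeal → w = v :=
    fun w hw ↦ eq_of_natCast_mem_of_asIdeal_eq_span hv w hw
  set 𝔓₀ := adicCompletionPrime K v with h𝔓₀def
  have h𝔓₀ : 𝔓₀ ∈ v.primesAbove := adicCompletionPrime_mem_primesAbove K v
  have hDrange := decompositionSubgroup_adicCompletionPrime_eq_range K v
  have hDfix : 𝔓₀.decompositionSubgroup (absoluteGaloisGroup K) ≤
      torsionFixing (W.baseChange K) n :=
    GlobalDuality.decompositionSubgroup_le_torsionFixing W K hK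
      ⟨hℓp, hℓN, (hcK ℓ hℓ).1.2.2.1, hℓnep, hinertℓ, (hcK ℓ hℓ).1.2.2.2.2.2⟩ hkM v hℓv h𝔓₀
  have hresD : ∀ σ : absoluteGaloisGroup (v.adicCompletion K),
      absGaloisRestrict K (v.adicCompletion K) σ ∈ 𝔓₀.decompositionSubgroup (absoluteGaloisGroup K) := fun σ ↦ by
    rw [hDrange]; exact ⟨σ, rfl⟩
  -- the `ℓ`-power Frobenius of `𝔽̄_ℓ` and BRICK B2
  obtain ⟨φ₀, hφ₀'⟩ := WeierstrassCurve.exists_frobenius_absoluteGaloisGroup (ZMod ℓ)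
  have hφ₀ : ∀ x : AlgebraicClosure (ZMod ℓ), φ₀ • x = x ^ ℓ := fun x ↦ by
    rw [hφ₀' x, Nat.card_zmod]
  obtain ⟨red, hsurj, hredI, hredF, hredinj⟩ :=
    exists_kolyvaginReduction W hΔ hφ₀ hℓv huniq h𝔓₀
  -- BRICK B3: `red P = p^k • b`, `φ₀² b = b`
  obtain ⟨b, hb, hφb⟩ := exists_red_derivedPoint_eq_pow_smul hK ι hc hℓp hℓc hinert hp hp2 hpk
    hv h𝔓₀ d φ₀ red hredI (fun g hg ↦ hredF g 2 hg)
  -- a Frobenius at `𝔓₀` fixing `K[c]` (hence `E[p^k]`), so `φ₀²` fixes `Ẽ[p^k]`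
  let e : ringClassField K ι c →ₐ[K] AlgebraicClosure K := { d.emb with commutes' := d.emb_apply }
  have he : ∀ x, e x = d.emb x := fun _ ↦ rfl
  obtain ⟨Fr, hFrz, -⟩ := exists_frobSq_forall_smul_emb_eq hK ι hc hℓp hℓc hinertℓ hv h𝔓₀ e
  have hFrD : Fr ∈ 𝔓₀.decompositionSubgroup (absoluteGaloisGroup K) := by
    haveI := h𝔓₀.1
    have hFr : IsArithFrobAt (𝓞 K) Fr 𝔓₀ := by
      rw [HeightOneSpectrum.isArithFrobAt_iff_of_mem_primesAbove h𝔓₀,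
        residueCard_eq_sq_of_asIdeal_eq_span hK hℓp hinertℓ hv]
      exact hFrz
    exact hFr.mem_stabilizer
  have hφtors : ∀ b' : (reductionModPrime W ℓ).geomPoints, ((p ^ k : ℕ) : ℤ) • b' = 0 →
      (φ₀ ^ 2) • b' = b' := by
    intro b' hb'
    obtain ⟨Q', hQ'0, rfl⟩ := exists_torsion_lift_baseChange W hΔ hredinj hℓpk hpk0 b' hb'
    rw [← hredF Fr 2 hFrz]
    congr 1
    have hQ'mem : Q' ∈ geomTorsion (W.baseChange K) n := (mem_geomTorsion_iff _ _ _).mpr hQ'0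
    exact congrArg Subtype.val ((mem_torsionFixing_iff _ _).mp (hDfix hFrD) ⟨Q', hQ'mem⟩)
  -- `φ₀²` fixes `red Q`
  have hφQ : (φ₀ ^ 2) • red Q = red Q := by
    have h1 : ((p ^ k : ℕ) : ℤ) • (red Q - b) = 0 := by
      rw [smul_sub, ← map_zsmul, ← hn, hQ, hPdef, hb, hn, natCast_zsmul, sub_self]
    have h2 := hφtors _ h1
    rw [smul_sub, hφb] at h2
    exact sub_left_injective h2
  have hφQ' : ∀ j : ℕ, (φ₀ ^ (2 * j)) • red Q = red Q := by
    intro j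
    induction j with
    | zero => rw [mul_zero, pow_zero, one_smul]
    | succ j ih => rw [Nat.mul_succ, pow_add, mul_smul, hφQ, ih]
  -- the key vanishing: for `g ∈ D_{𝔓₀}` fixing `P` with `red (g • Q) = red Q`, `φ g = 0`
  have hcont := continuous_smul_geomPoints (W.baseChange K)
  have hval : ∀ g : absoluteGaloisGroup K, g • P = P → red (g • Q) = red Q →
      (KolyvaginCocycle.cocycle hA hcont hPinv hQ).1 g = 0 := by
    intro g hgP hgQ
    apply Subtype.ext
    rw [KolyvaginCocycle.coe_cocycle_apply, hgP, sub_self,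
      KolyvaginCocycle.rootIn_zero hA.eq_zero_of_zsmul, sub_zero]
    change g • Q - Q = ((0 : geomTorsion (W.baseChange K) n) : geomPoints (W.baseChange K))
    rw [ZeroMemClass.coe_zero]
    refine hredinj (p ^ k) hℓpk _ ?_ (by rw [map_sub, hgQ, sub_self])
    rw [smul_sub, ← hn, ← KolyvaginCocycle.smul_zsmul_comm, hQ, hgP, sub_self]
  -- transverse kernel: every place `w' ∋ ℓ` of `K[ℓ]`
  refine (mem_transverseKer_iff W K ι n ℓ _).mpr fun w' hw' ↦ ?_
  -- `w'` lies over `λ`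
  have hunder : ((ℓ : ℕ) : 𝓞 K) ∈ w'.asIdeal.under (𝓞 K) := by
    rw [Ideal.under, Ideal.mem_comap, map_natCast]; exact hw'
  have hne' : w'.asIdeal.under (𝓞 K) ≠ ⊥ := by
    intro hbot; rw [hbot, Ideal.mem_bot] at hunder; exact hℓp.ne_zero (by exact_mod_cast hunder)
  have hv₀ : (⟨w'.asIdeal.under (𝓞 K), Ideal.IsPrime.under (𝓞 K) w'.asIdeal, hne'⟩ :
      HeightOneSpectrum (𝓞 K)) = v := huniq _ hunder
  haveI hLO : w'.asIdeal.LiesOver v.asIdeal := ⟨by rw [← hv₀]⟩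
  haveI := (finiteDimensional_and_isGalois_ringClassField hK ι hℓp.ne_zero).2
  letI := (adicCompletionOfLiesOver K (ringClassField K ι ℓ) v w').toAlgebra
  refine (localization_mem_transverseSubgroup_iff ρK (ringClassField K ι ℓ) v w' _).mp ?_
  change galoisCohomology.localization ρK (Sum.inr v) 1
      (oneCocycleClass _ (KolyvaginCocycle.cocycle hA hcont hPinv hQ)) ∈ _
  refine localization_mem_transverseSubgroup_of_forall_apply_eq_zero (W.baseChange K) n
    (ringClassField K ι ℓ) v w' _ ?_
  -- the local cocycle on `Γ_{(w'.adicCompletion (ringClassField K ι ℓ))}`: a homomorphism, unramified, killed by a Frobenius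
  let θ' : absoluteGaloisGroup (w'.adicCompletion (ringClassField K ι ℓ)) →ₜ* absoluteGaloisGroup (v.adicCompletion K) := absGaloisRestrict (v.adicCompletion K) (w'.adicCompletion (ringClassField K ι ℓ))
  let ρL : DiscreteGaloisModule (w'.adicCompletion (ringClassField K ι ℓ)) (geomTorsion (W.baseChange K) n) :=
    (GaloisRep.toLocal v ρK).restrictField (w'.adicCompletion (ringClassField K ι ℓ))
  let ψL : contOneCocycles ρL.toTopRep :=
    contOneCocycles.pullback θ' (TopRep.ofHom ⟨ContinuousLinearMap.id ℤ _, fun _ => rfl⟩)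
      (contOneCocycles.pullback (absGaloisRestrict K (v.adicCompletion K))
        (TopRep.ofHom ⟨ContinuousLinearMap.id ℤ _, fun _ => rfl⟩)
        (KolyvaginCocycle.cocycle hA hcont hPinv hQ))
  have hψL : ∀ g', ψL.1 g' =
      (KolyvaginCocycle.cocycle hA hcont hPinv hQ).1 (absGaloisRestrict K (v.adicCompletion K) (θ' g')) := fun g' ↦ by
    rw [contOneCocycles.pullback_apply, contOneCocycles.pullback_apply]; rfl
  -- elements of `range θ'` fix `K[ℓ]` (FILE A), hence `K[c]` (BRICK B1), hence `P`
  let ιE : ringClassField K ι ℓ →ₐ[K] AlgebraicClosure K := IsAlgClosed.lift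
  have hle : ringClassField K ι ℓ ≤ ringClassField K ι c := ringClassField_mono hK ι hℓc hc0
  obtain ⟨γ, hγ⟩ := RingClassConj.exists_algEquiv_forall_apply_eq hK ι hℓp.ne_zero
    (ιE : ringClassField K ι ℓ →+* AlgebraicClosure K)
    ((e : ringClassField K ι c →+* AlgebraicClosure K).comp
      (RingClassField.inclusion ι hle : ringClassField K ι ℓ →+* ringClassField K ι c))
  have hfixP : ∀ g' : absoluteGaloisGroup (w'.adicCompletion (ringClassField K ι ℓ)), absGaloisRestrict K (v.adicCompletion K) (θ' g') • P = P := by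
    intro g'
    have hfixℓ : ∀ y : ringClassField K ι ℓ,
        absGaloisRestrict K (v.adicCompletion K) (θ' g') • ιE y = ιE y :=
      (SemiLocal.mem_range_absGaloisRestrict_adicCompletion_iff v ιE w' (θ' g')).mp ⟨g', rfl⟩
    have hfixc : ∀ x : ringClassField K ι c, absGaloisRestrict K (v.adicCompletion K) (θ' g') • e x = e x := by
      refine smul_ringClassField_emb_eq_of_mem_decompositionSubgroup hK hD ι hc hℓp hℓc hinert hv
        h𝔓₀ e (hresD _) fun x hx ↦ ?_
      let x' : ringClassField K ι ℓ := ⟨(x : ℂ), hx⟩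
      have hxx' : x = RingClassField.inclusion ι hle x' :=
        Subtype.ext (by rw [RingClassField.coe_inclusion])
      have hex : e x = ιE (γ x') := by rw [hxx']; exact hγ x'
      rw [hex, hfixℓ]
    exact smul_toGeomPoints_eq_self_of_forall_smul_emb d (fun x ↦ by rw [← he]; exact hfixc x) _
  -- pv-1's lemma on the local field `(w'.adicCompletion (ringClassField K ι ℓ)) = K[ℓ]_{w'}`
  have htriv : ∀ (g' : absoluteGaloisGroup (w'.adicCompletion (ringClassField K ι ℓ))) (w : geomTorsion (W.baseChange K) n), ρL g' w = w := by
    intro g' w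
    change absGaloisRestrict K (v.adicCompletion K) (θ' g') • w = w
    exact (mem_torsionFixing_iff _ _).mp (hDfix (hresD _)) w
  obtain ⟨φL, hφL⟩ := exists_isFrobPow_holds (F := (w'.adicCompletion (ringClassField K ι ℓ))) 1
  have hI : ∀ τ ∈ absInertia (w'.adicCompletion (ringClassField K ι ℓ)), ψL.1 τ = 0 := by
    intro τ hτ
    rw [hψL]
    have hτF : θ' τ ∈ absInertia (v.adicCompletion K) :=
      absInertia_map_absGaloisRestrict_le_holds (v.adicCompletion K) (w'.adicCompletion (ringClassField K ι ℓ)) ⟨τ, hτ, rfl⟩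
    have hτI : absGaloisRestrict K (v.adicCompletion K) (θ' τ) ∈ 𝔓₀.inertia (absoluteGaloisGroup K) := by
      rw [h𝔓₀def, inertia_adicCompletionPrime_eq_map_absInertia K v]
      exact ⟨θ' τ, hτF, rfl⟩
    exact hval _ (hfixP τ) (hredI _ hτI Q)
  have hφ0 : ψL.1 φL = 0 := by
    rw [hψL]
    -- `θ' φL` is a Frobenius power of exponent `f` for `K_v`, `q_v = ℓ²`
    set f := w'.asIdeal.inertiaDeg (𝓞 K) with hfdef
    have hqv : residueFieldCard (v.adicCompletion K) = ℓ ^ 2 := by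
      rw [residueFieldCard_adicCompletion_eq, residueCard_eq_sq_of_asIdeal_eq_span hK hℓp hinertℓ hv]
    have hqL : residueFieldCard (w'.adicCompletion (ringClassField K ι ℓ)) = residueFieldCard (v.adicCompletion K) ^ f := by
      rw [residueFieldCard_adicCompletion_eq, residueFieldCard_adicCompletion_eq]
      exact residueCard_eq_residueCard_pow_inertiaDeg hLO.over.symm
    have hfrob : IsFrobPow (θ' φL) ((f : ℤ) * 1) := IsFrobPow.absGaloisRestrict_holds (F := (v.adicCompletion K)) hφL f hqL
    rw [mul_one] at hfrob
    have hfrob' := isFrobPow_natCast_iff.mp hfrob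
    rw [hqv, ← pow_mul] at hfrob'
    have hg : ∀ z : absIntegers (𝓞 K) K,
        absGaloisRestrict K (v.adicCompletion K) (θ' φL) • z - z ^ (ℓ ^ (2 * f)) ∈ 𝔓₀ := fun z ↦
      forall_smul_sub_pow_mem_adicCompletionPrime v hfrob' z
    refine hval _ (hfixP φL) ?_
    rw [hredF _ (2 * f) hg, hφQ' f]
  intro g'
  have := GlobalDuality.apply_eq_zero_of_unramified_of_apply_frob_eq_zero ρL htriv hφL ψL hI hφ0 g'
  rwa [hψL] at this

end Main

end Summit.BirchSwinnertonDyer.Rank1Residual.JET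

end
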